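import Summits.QuantumFields.YangMills.Theorems.VirialFluxGapRegularValleyLocalise
import HarnessLib

/-!
# Route `VirialFluxGap` (YangMills): an EXPLICIT near zero for a regular ring history (the `sInf`-free form of ✓`regular_linear_localise`)

For the resolvent ∕ Euler-field constructions of crux ⟨stmt-QuantumFields-24141⟩ (fcl-p3 g40's `X_g = ½(H+λ*)⁻¹∇F₀`: «one-variable Taylor along
`P·exp(su)` to the nearest zero, w2's κ»): a ρ-regular ring history `P` has an EXPLICIT flat ring `Q` (`F₀(Q) = 0`) — the comb-flat ring of the
projected comb data of ✓`exists_flat_ring_near_of_far` — with per-link Frobenius bounds AND total squared chordal ring distance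
`D(P,Q) = Σ_{i}(6L³ − timeCoupling(P_i,Q_i)) + Σ_x(2 − Re tr(P.2 x (Q.2 x)⁻¹)) ≤ 21520·L⁸·F₀(P)/ρ²`, so that the quadratic growth reads
`F₀(P) ≥ ρ²·D(P,Q)/(21520L⁸)` at a CONCRETE zero `Q` (no infimum): ★ `exists_zero_near_of_regular`.

HONEST FRAMING: bookkeeping corollary; ⟨24141⟩ stays OPEN; the Yang–Mills mass gap is NOT proved; no summit is proved by a line.  ROUTE-INDEPENDENT.
THEOREMS ONLY (no definition, no `sorry`), standard axioms.  Width seat `ym-line-sfw-p2-w2` g51, `--supports stmt-QuantumFields-24141`.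
References: [cite: Luscher1983, §2].
-/

set_option autoImplicit false

noncomputable section

open scoped Quaternion Matrix BigOperators
open Literature.MathematicalPhysics.QuantumFieldTheory hiding SU2
open Literature.MathematicalPhysics.QuantumLattice

namespace Summit.QuantumFields.YangMills.Theorems.VirialFluxGap.RegularValley

open Summit.QuantumFields.YangMills.Theorems.FemtoTransferGap
open Summit.QuantumFields.YangMills.Theorems.FemtoTransferGap.TT
open Summit.QuantumFields.YangMills.Theorems.FemtoTransferGap.TwoLattice
open Summit.QuantumFields.YangMills.Theorems.FemtoTransferGap.TwoLattice.Flat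
open Summit.QuantumFields.YangMills.Theorems.VirialFluxGap.RingDeficit
open Summit.QuantumFields.YangMills.Theorems.ToronValleyVolume.Lojasiewicz

variable {L : ℕ} [NeZero L]

/-- ★ **An explicit flat ring `Q` near a ρ-regular ring history `P`, with `D(P,Q) ≤ 21520·L⁸·F₀(P)/ρ²`.** [cite: Luscher1983, §2] -/
theorem exists_zero_near_of_regular (P : (Fin (2 * L - 1 + 1) → GaugeConfig 3 L SU2) × (Site 3 L → SU2)) {ρ : ℝ} (hρ : 0 < ρ)
    (hfar : (∃ k : Fin 3, ρ ^ 2 ≤ 1 - (su2Quat (wrapReps (P.1 0) k)).re ^ 2) ∨ ρ ^ 2 ≤ 1 - (su2Quat (P.2 0)).re ^ 2) :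
    ∃ Q : (Fin (2 * L - 1 + 1) → GaugeConfig 3 L SU2) × (Site 3 L → SU2),
      ringDeficit L (fun _ => false) Q = 0 ∧
      (∀ (i : Fin (2 * L - 1 + 1)) (e : Edge 3 L), fd (P.1 i e) (Q.1 i e) ≤
        4 * (L : ℝ) * Real.sqrt (ringDeficit L (fun _ => false) P) + 12 * (L : ℝ) ^ 2 * Real.sqrt (ringDeficit L (fun _ => false) P) +
          40 * (L : ℝ) ^ 2 * Real.sqrt (ringDeficit L (fun _ => false) P) / ρ) ∧
      (∀ x : Site 3 L, fd (P.2 x) (Q.2 x) ≤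
        12 * (L : ℝ) ^ 2 * Real.sqrt (ringDeficit L (fun _ => false) P) + 40 * (L : ℝ) ^ 2 * Real.sqrt (ringDeficit L (fun _ => false) P) / ρ) ∧
      (∑ i : Fin (2 * L - 1 + 1), (6 * (L : ℝ) ^ 3 - timeCoupling su2Rep (P.1 i) (Q.1 i))) +
          ∑ x : Site 3 L, (2 - ((su2Rep (P.2 x * (Q.2 x)⁻¹)).trace).re) ≤
        21520 * (L : ℝ) ^ 8 * ringDeficit L (fun _ => false) P / ρ ^ 2 := by
  set ε := ringDeficit L (fun _ => false) P with hε
  have hε0 : 0 ≤ ε := ringDeficit_nonneg _ _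
  have hL1 : (1 : ℝ) ≤ L := by exact_mod_cast NeZero.one_le
  set δ := Real.sqrt ε with hδ
  have hδ0 : 0 ≤ δ := Real.sqrt_nonneg _
  have hδ2 : δ ^ 2 = ε := Real.sq_sqrt hε0
  have hρ1 : ρ ≤ 1 := by
    have hρ2 : ρ ^ 2 ≤ 1 := by
      rcases hfar with ⟨k, hk⟩ | h0
      · nlinarith [sq_nonneg (su2Quat (wrapReps (P.1 0) k)).re]
      · nlinarith [sq_nonneg (su2Quat (P.2 0)).re]
    nlinarith
  have hfar' : (∃ k : Fin 3, ρ ^ 2 ≤ ((su2Quat (wrapReps (P.1 0) k)).imI * (su2Quat (wrapReps (P.1 0) k)).imI +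
        (su2Quat (wrapReps (P.1 0) k)).imJ * (su2Quat (wrapReps (P.1 0) k)).imJ + (su2Quat (wrapReps (P.1 0) k)).imK * (su2Quat (wrapReps (P.1 0) k)).imK)) ∨
      ρ ^ 2 ≤ ((su2Quat (P.2 0)).imI * (su2Quat (P.2 0)).imI + (su2Quat (P.2 0)).imJ * (su2Quat (P.2 0)).imJ +
        (su2Quat (P.2 0)).imK * (su2Quat (P.2 0)).imK) := by
    rcases hfar with ⟨k, hk⟩ | h0
    · exact Or.inl ⟨k, by rw [imDot_su2Quat_eq]; exact hk⟩
    · exact Or.inr (by rw [imDot_su2Quat_eq]; exact h0)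
  obtain ⟨Q, hQ0, hQ1, hQ2⟩ := exists_flat_ring_near_of_far P hρ hfar'
  refine ⟨Q, hQ0, hQ1, hQ2, ?_⟩
  set B₁ := 4 * (L : ℝ) * δ + 12 * (L : ℝ) ^ 2 * δ + 40 * (L : ℝ) ^ 2 * δ / ρ with hB₁
  set B₂ := 12 * (L : ℝ) ^ 2 * δ + 40 * (L : ℝ) ^ 2 * δ / ρ with hB₂
  have hs1 : ∀ i : Fin (2 * L - 1 + 1), 6 * (L : ℝ) ^ 3 - timeCoupling su2Rep (P.1 i) (Q.1 i) ≤ 3 * (L : ℝ) ^ 3 * B₁ ^ 2 := fun i => by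
    rw [timeCoupling_deficit_eq]
    calc ∑ e : Edge 3 L, ‖su2Quat (P.1 i e) - su2Quat (Q.1 i e)‖ ^ 2 ≤ ∑ _e : Edge 3 L, B₁ ^ 2 :=
          Finset.sum_le_sum fun e _ => (pow_le_pow_left₀ (norm_nonneg _) (norm_su2Quat_sub_le_fd _ _) 2).trans
            (pow_le_pow_left₀ (frobNorm_nonneg _) (hQ1 i e) 2)
      _ = 3 * (L : ℝ) ^ 3 * B₁ ^ 2 := by rw [Finset.sum_const, Finset.card_univ, nsmul_eq_mul, ConstTube.card_edge_three L]
  have hs2 : ∀ x : Site 3 L, 2 - ((su2Rep (P.2 x * (Q.2 x)⁻¹)).trace).re ≤ B₂ ^ 2 := fun x => by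
    rw [ConstTube.re_trace_su2Rep_mul_inv_eq_norm]
    have := (pow_le_pow_left₀ (norm_nonneg _) (norm_su2Quat_sub_le_fd (P.2 x) (Q.2 x)) 2).trans
      (pow_le_pow_left₀ (frobNorm_nonneg _) (hQ2 x) 2)
    linarith
  have hcardI : (Fintype.card (Fin (2 * L - 1 + 1)) : ℝ) = 2 * (L : ℝ) := by
    rw [Fintype.card_fin]
    have hL : 1 ≤ L := NeZero.one_le
    rw [show 2 * L - 1 + 1 = 2 * L by omega]; push_cast; ring
  have hcardS : (Fintype.card (Site 3 L) : ℝ) = (L : ℝ) ^ 3 := by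
    rw [Fintype.card_pi, Finset.prod_const, Finset.card_univ, Fintype.card_fin, ZMod.card]; push_cast; ring
  have hA : (∑ i : Fin (2 * L - 1 + 1), (6 * (L : ℝ) ^ 3 - timeCoupling su2Rep (P.1 i) (Q.1 i))) ≤ 2 * (L : ℝ) * (3 * (L : ℝ) ^ 3) * B₁ ^ 2 := by
    calc (∑ i : Fin (2 * L - 1 + 1), (6 * (L : ℝ) ^ 3 - timeCoupling su2Rep (P.1 i) (Q.1 i))) ≤ ∑ _i : Fin (2 * L - 1 + 1), 3 * (L : ℝ) ^ 3 * B₁ ^ 2 :=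
          Finset.sum_le_sum fun i _ => hs1 i
      _ = 2 * (L : ℝ) * (3 * (L : ℝ) ^ 3) * B₁ ^ 2 := by rw [Finset.sum_const, Finset.card_univ, nsmul_eq_mul, hcardI]; ring
  have hB : ∑ x : Site 3 L, (2 - ((su2Rep (P.2 x * (Q.2 x)⁻¹)).trace).re) ≤ (L : ℝ) ^ 3 * B₂ ^ 2 := by
    calc ∑ x : Site 3 L, (2 - ((su2Rep (P.2 x * (Q.2 x)⁻¹)).trace).re) ≤ ∑ _x : Site 3 L, B₂ ^ 2 := Finset.sum_le_sum fun x _ => hs2 x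
      _ = (L : ℝ) ^ 3 * B₂ ^ 2 := by rw [Finset.sum_const, Finset.card_univ, nsmul_eq_mul, hcardS]
  have harith := constants_arith_far hL1 hδ0 hρ hρ1
  rw [← hB₁, ← hB₂, hδ2] at harith
  linarith

end Summit.QuantumFields.YangMills.Theorems.VirialFluxGap.RegularValley

end
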